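import Literature.NumberTheory.GaloisRepresentations.ContinuousCohomologyConnecting
import Mathlib.Topology.Instances.ZMod
import HarnessLib

/-!
# `H²` of a cyclic layer, I: the carry cocycle and the classes `κ(a)` (Serre, *Corps locaux* VIII §4, XIII §3)

Let `G` be a topological group and `χ : G → ℤ/d` a continuous surjective homomorphism with kernel
`T` (a *cyclic layer*: `G/T ≅ ℤ/d`), and let `A` be a discrete `G`-module.  Classically
`H²(G/T, A^T) ≅ Ĥ⁰(G/T, A^T) = A^G / N_{G/T} A^T` for the cyclic group `G/T` (Serre, *Corps
locaux*, VIII §4; via the cup product with `δχ ∈ H²(G/T, ℤ)`, XIII §3–4 and XIV §1 for the norm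
residue symbol `(χ, b) = b ∪ δχ`), and `H²(G/T, A^T) → H²(G, A)` is the inflation, injective with
image `ker(res : H²(G, A) → H²(T, A))` when `H¹(T, A) = 0` (VII §6 Prop. 5).  This file and its
sequel prove the resulting description of `ker res` directly on continuous cochains of `G`:

* `CyclicCharacter G d`, its kernel `T`, the lift `χ̃ : G → ℤ` (`0 ≤ χ̃ < d`);
* the **carry cocycle** `c_χ : G × G → ℤ`, `c_χ(σ, τ) = (χ̃ σ + χ̃ τ - χ̃(στ))/d ∈ {0, 1}`
  (`CyclicCharacter.carryFun`, its cocycle identity `carryFun_cocycle`), i.e. the inhomogeneous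
  cocycle of the Bockstein `δχ ∈ H²(G, ℤ)` of `χ` for `0 → ℤ →(d) ℤ → ℤ/d → 0` (kept as an
  integer-valued function: the trivial module `ℤ` does not live in the universe of `G`);
* for `a ∈ A^G` the class **`κ(a) = a ∪ δχ = [c_χ ⊗ a] ∈ H²(G, A)`** (`cyclicClass`; additive in
  `a`), with `res_T κ(a) = 0` (`map_res_cyclicClass`);
* the norm `N_s b = Σ_{k<d} s^k b` of a `T`-invariant `b` for `χ(s) = 1` (`cycNorm`) and
  **`κ(N_s b) = 0`** (`cyclicClass_cycNorm`: explicit coboundary `β(σ) = Σ_{k < χ̃ σ} s^k b`,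
  `carryFun_smul_cycNorm`);
* **`κ(a) = 0 ⇒ a = N_s b` for some `b ∈ A^T`, when `H¹(T, A) = 0`**
  (`exists_cycNorm_eq_of_cyclicClass_eq_zero`: if `c_χ ⊗ a = dβ`, normalise `β|_T = 0` by
  Hilbert 90 for `T`, then `β` is constant on cosets with values in `A^T`, `β(sⁱ) = Σ_{k<i} s^k β(s)`
  and `a = N_s β(s)`).

Together with the sequel (`ker res ⊆ im κ`) this gives `ker(res : H²(G, A) → H²(T, A)) ≅
A^G / N A^T`, e.g. `Br(L/K) ≅ Kˣ / N_{L/K} Lˣ` for a cyclic extension `L/K` of fields.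

## References

* J.-P. Serre, *Corps locaux* (1968) / *Local Fields* (1979), VII §6 Prop. 5, VIII §4,
  XIII §3–4, XIV §1 Prop. 2–3. [SerreLocalFields1979]
* J. Neukirch, A. Schmidt, K. Wingberg, *Cohomology of Number Fields* (2008), (1.6.7), I §7
  (cyclic groups). [NeukirchSchmidtWingberg2008]
-/

noncomputable section

open CategoryTheory Limits Function

universe u

namespace Literature.NumberTheory.GaloisRepresentations

open _root_.TopRep _root_.ContRepresentation _root_.ContinuousCohomology

/-! ### Cyclic characters -/

/-- A **cyclic layer** of a topological group `G`: a continuous surjective homomorphism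
`χ : G → ℤ/d` (written additively); its kernel `T` is an open normal subgroup with `G/T ≅ ℤ/d`.
[cite: SerreLocalFields1979, XIII §3] -/
structure CyclicCharacter (G : Type u) [Group G] [TopologicalSpace G] (d : ℕ) where
  /-- the character -/
  toFun : G → ZMod d
  /-- multiplicativity -/
  map_mul' : ∀ σ τ, toFun (σ * τ) = toFun σ + toFun τ
  /-- continuity (for the discrete topology on `ℤ/d`) -/
  continuous_toFun : Continuous toFun
  /-- surjectivity -/
  surjective' : Surjective toFun

namespace CyclicCharacter

variable {G : Type u} [Group G] [TopologicalSpace G] {d : ℕ} (χ : CyclicCharacter G d)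

/-- A cyclic character is a function. [folklore] -/
instance instCoeFun : CoeFun (CyclicCharacter G d) fun _ => G → ZMod d := ⟨CyclicCharacter.toFun⟩

/-- `χ(στ) = χ σ + χ τ`. [folklore] -/
theorem map_mul (σ τ : G) : χ (σ * τ) = χ σ + χ τ := χ.map_mul' σ τ

/-- `χ 1 = 0`. [folklore] -/
theorem map_one : χ 1 = 0 := by
  have h := χ.map_mul 1 1
  rw [mul_one] at h
  exact left_eq_add.1 h

/-- `χ σ⁻¹ = -χ σ`. [folklore] -/
theorem map_inv (σ : G) : χ σ⁻¹ = -χ σ := by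
  have h := χ.map_mul σ⁻¹ σ
  rw [inv_mul_cancel, map_one] at h
  exact eq_neg_of_add_eq_zero_left h.symm

/-- `χ (sⁱ) = i • χ s`. [folklore] -/
theorem map_pow (s : G) (i : ℕ) : χ (s ^ i) = i • χ s := by
  induction i with
  | zero => rw [pow_zero, map_one, zero_smul]
  | succ i ih => rw [pow_succ, map_mul, ih, succ_nsmul]

/-- Continuity of `χ`. [folklore] -/
theorem continuous : Continuous χ := χ.continuous_toFun

/-- Surjectivity of `χ`. [folklore] -/
theorem surjective : Surjective χ := χ.surjective'

/-- The kernel `T` of the character, a subgroup. [folklore] -/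
def ker : Subgroup G where
  carrier := {σ | χ σ = 0}
  mul_mem' {a b} ha hb := by
    change χ (a * b) = 0
    rw [map_mul, show χ a = 0 from ha, show χ b = 0 from hb, add_zero]
  one_mem' := χ.map_one
  inv_mem' {a} ha := by
    change χ a⁻¹ = 0
    rw [map_inv, show χ a = 0 from ha, neg_zero]

/-- Membership in the kernel. [folklore] -/
@[simp] theorem mem_ker {σ : G} : σ ∈ χ.ker ↔ χ σ = 0 := Iff.rfl

/-- The kernel is normal. [folklore] -/
instance normal_ker : χ.ker.Normal :=
  ⟨fun t ht g => by
    rw [mem_ker] at ht ⊢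
    rw [map_mul, map_mul, ht, add_zero, map_inv, add_neg_cancel]⟩

/-- The kernel is open. [folklore] -/
theorem isOpen_ker : IsOpen (χ.ker : Set G) :=
  (isOpen_discrete {(0 : ZMod d)}).preimage χ.continuous

/-- The kernel is closed. [folklore] -/
theorem isClosed_ker : IsClosed (χ.ker : Set G) :=
  (isClosed_discrete {(0 : ZMod d)}).preimage χ.continuous

/-- `χ σ = χ (s ^ (χ σ).val)` when `χ s = 1`. [folklore] -/
theorem map_pow_val [NeZero d] {s : G} (hs : χ s = 1) (σ : G) : χ (s ^ (χ σ).val) = χ σ := by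
  rw [map_pow, hs, nsmul_eq_mul, mul_one, ZMod.natCast_zmod_val]

/-- `σ = s^{χ̃ σ} t` with `t ∈ T`. [folklore] -/
theorem pow_val_inv_mul_mem_ker [NeZero d] {s : G} (hs : χ s = 1) (σ : G) :
    (s ^ (χ σ).val)⁻¹ * σ ∈ χ.ker := by
  rw [mem_ker, map_mul, map_inv, map_pow_val χ hs, neg_add_cancel]

/-- `(χ (sⁱ)).val = i` for `i < d`, when `χ s = 1`. [folklore] -/
theorem val_map_pow [NeZero d] {s : G} (hs : χ s = 1) {i : ℕ} (hi : i < d) :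
    (χ (s ^ i)).val = i := by
  rw [map_pow, hs, nsmul_eq_mul, mul_one, ZMod.val_natCast, Nat.mod_eq_of_lt hi]

/-- `s ^ d ∈ T`. [folklore] -/
theorem pow_mem_ker {s : G} (hs : χ s = 1) : s ^ d ∈ χ.ker := by
  rw [mem_ker, map_pow, hs, nsmul_eq_mul, mul_one, ZMod.natCast_self]

/-- There is `s` with `χ s = 1`. [folklore] -/
theorem exists_map_eq_one : ∃ s : G, χ s = 1 := χ.surjective 1

/-- **The lift `χ̃ : G → ℤ`, `0 ≤ χ̃ < d`**, a continuous (locally constant) function. [folklore] -/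
def lift : C(G, ℤ) :=
  ⟨fun σ => ((χ σ).val : ℤ), (continuous_of_discreteTopology (f := fun x : ZMod d => (x.val : ℤ))).comp
    χ.continuous⟩

/-- Unfolding `lift`. [folklore] -/
@[simp] theorem lift_apply (σ : G) : χ.lift σ = ((χ σ).val : ℤ) := rfl

/-- `χ̃` reduces to `χ`. [folklore] -/
theorem intCast_lift [NeZero d] (σ : G) : ((χ.lift σ : ℤ) : ZMod d) = χ σ := by
  rw [lift_apply, Int.cast_natCast, ZMod.natCast_zmod_val]

end CyclicCharacter

/-! ### The carry cocycle -/

namespace CyclicCharacter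

variable {G : Type u} [Group G] [TopologicalSpace G] {d : ℕ} [NeZero d] (χ : CyclicCharacter G d)

/-- **The carry cocycle `c_χ : G × G → ℤ`**, `c_χ(σ, τ) = ⌊(χ̃ σ + χ̃ τ)/d⌋ ∈ {0, 1}`: the
inhomogeneous `2`-cocycle `δχ` of the Bockstein of `χ` for `0 → ℤ → ℤ → ℤ/d → 0`
(`d · c_χ(σ, τ) = χ̃ σ + χ̃ τ - χ̃(στ)`). [cite: SerreLocalFields1979, XIV §1] -/
def carryFun (σ τ : G) : ℤ := (((χ σ).val + (χ τ).val) / d : ℕ)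

/-- `d · c_χ(σ, τ) = χ̃ σ + χ̃ τ - χ̃(στ)`. [folklore] -/
theorem natCast_mul_carryFun (σ τ : G) :
    (d : ℤ) * χ.carryFun σ τ = ((χ σ).val : ℤ) + ((χ τ).val : ℤ) - ((χ (σ * τ)).val : ℤ) := by
  rw [carryFun, map_mul, ZMod.val_add]
  have hdm := Nat.div_add_mod ((χ σ).val + (χ τ).val) d
  have : (((χ σ).val + (χ τ).val : ℕ) : ℤ) =
      (d : ℤ) * (((χ σ).val + (χ τ).val) / d : ℕ) + (((χ σ).val + (χ τ).val) % d : ℕ) := by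
    exact_mod_cast hdm.symm
  push_cast at this ⊢
  linarith

/-- **The `2`-cocycle identity of the carry**: `c(τ, υ) + c(σ, τυ) = c(στ, υ) + c(σ, τ)`.
[folklore] -/
theorem carryFun_cocycle (σ τ υ : G) :
    χ.carryFun τ υ + χ.carryFun σ (τ * υ) = χ.carryFun (σ * τ) υ + χ.carryFun σ τ := by
  have hd : (d : ℤ) ≠ 0 := Int.natCast_ne_zero.2 (NeZero.ne d)
  apply mul_left_cancel₀ hd
  rw [mul_add, mul_add, natCast_mul_carryFun, natCast_mul_carryFun, natCast_mul_carryFun,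
    natCast_mul_carryFun, mul_assoc]
  ring

omit [NeZero d] in
/-- `c_χ(σ, τ) = 0` if `χ̃ σ + χ̃ τ < d`. [folklore] -/
theorem carryFun_of_lt {σ τ : G} (h : (χ σ).val + (χ τ).val < d) : χ.carryFun σ τ = 0 := by
  rw [carryFun, Nat.div_eq_of_lt h, Nat.cast_zero]

/-- `c_χ(σ, τ) = 1` if `χ̃ σ + χ̃ τ ≥ d`. [folklore] -/
theorem carryFun_of_le {σ τ : G} (h : d ≤ (χ σ).val + (χ τ).val) : χ.carryFun σ τ = 1 := by
  rw [carryFun]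
  have hlt : (χ σ).val + (χ τ).val < d * 2 := by
    rw [mul_two]; exact Nat.add_lt_add (χ σ).val_lt (χ τ).val_lt
  have h1 : ((χ σ).val + (χ τ).val) / d = 1 :=
    Nat.eq_of_le_of_lt_succ
      ((Nat.le_div_iff_mul_le (Nat.pos_of_ne_zero (NeZero.ne d))).2 (by simpa using h))
      (Nat.div_lt_of_lt_mul hlt)
  rw [h1, Nat.cast_one]

/-- `c_χ` vanishes on `T × T`. [folklore] -/
theorem carryFun_of_mem_ker {t t' : G} (ht : t ∈ χ.ker) (ht' : t' ∈ χ.ker) : χ.carryFun t t' = 0 := by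
  refine χ.carryFun_of_lt ?_
  rw [(χ.mem_ker).1 ht, (χ.mem_ker).1 ht', ZMod.val_zero, add_zero]
  exact Nat.pos_of_ne_zero (NeZero.ne d)

/-- `c_χ(σ, t) = 0` for `t ∈ T`. [folklore] -/
theorem carryFun_right_of_mem_ker (σ : G) {t : G} (ht : t ∈ χ.ker) : χ.carryFun σ t = 0 := by
  refine χ.carryFun_of_lt ?_
  rw [(χ.mem_ker).1 ht, ZMod.val_zero, add_zero]
  exact (χ σ).val_lt

/-- `c_χ(t, τ) = 0` for `t ∈ T`. [folklore] -/
theorem carryFun_left_of_mem_ker {t : G} (ht : t ∈ χ.ker) (τ : G) : χ.carryFun t τ = 0 := by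
  refine χ.carryFun_of_lt ?_
  rw [(χ.mem_ker).1 ht, ZMod.val_zero, zero_add]
  exact (χ τ).val_lt

omit [NeZero d] in
/-- `c_χ` is continuous (locally constant). [folklore] -/
theorem continuous_carryFun : Continuous fun p : G × G => χ.carryFun p.1 p.2 :=
  (continuous_of_discreteTopology
    (f := fun q : ZMod d × ZMod d => (((q.1.val + q.2.val) / d : ℕ) : ℤ))).comp
    (χ.continuous.prodMap χ.continuous)

end CyclicCharacter

/-! ### Power sums and the norm of a cyclic layer -/

namespace ContinuousRep

section PowSum

variable {G : Type u} [Group G] [TopologicalSpace G]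
variable {A : Type u} [AddCommGroup A] [TopologicalSpace A]
variable (ρ : ContinuousRep G ℤ A) (s : G)

/-- The partial sums `Σ_{k<i} s^k x`. [folklore] -/
def powSum (i : ℕ) (x : A) : A := ∑ k ∈ Finset.range i, ρ (s ^ k) x

/-- `powSum 0 = 0`. [folklore] -/
@[simp] theorem powSum_zero (x : A) : ρ.powSum s 0 x = 0 := by simp [powSum]

/-- `powSum (i+1) x = powSum i x + s^i x`. [folklore] -/
theorem powSum_succ (i : ℕ) (x : A) : ρ.powSum s (i + 1) x = ρ.powSum s i x + ρ (s ^ i) x := by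
  simp [powSum, Finset.sum_range_succ]

/-- `powSum 1 x = x`. [folklore] -/
@[simp] theorem powSum_one (x : A) : ρ.powSum s 1 x = x := by
  rw [powSum_succ, powSum_zero, zero_add, pow_zero, map_one, Module.End.one_apply]

/-- `powSum (i+j) x = powSum i x + s^i (powSum j x)`. [folklore] -/
theorem powSum_add (i j : ℕ) (x : A) :
    ρ.powSum s (i + j) x = ρ.powSum s i x + ρ (s ^ i) (ρ.powSum s j x) := by
  simp only [powSum, Finset.sum_range_add, map_sum, pow_add, map_mul, Module.End.mul_apply]

/-- `powSum` is additive in `x`. [folklore] -/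
theorem powSum_add_right (i : ℕ) (x y : A) :
    ρ.powSum s i (x + y) = ρ.powSum s i x + ρ.powSum s i y := by
  simp [powSum, Finset.sum_add_distrib]

/-- **The norm `N_s x = Σ_{k<d} s^k x` of the cyclic layer.** [cite: SerreLocalFields1979, VIII §4] -/
def cycNorm (d : ℕ) (x : A) : A := ρ.powSum s d x

/-- `s` fixes `N_s x` when `s^d` fixes `x`. [folklore] -/
theorem apply_cycNorm {d : ℕ} {x : A} (hx : ρ (s ^ d) x = x) : ρ s (ρ.cycNorm s d x) = ρ.cycNorm s d x := by
  have h := ρ.powSum_add s 1 d x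
  rw [pow_one, powSum_one, add_comm 1 d, powSum_succ, hx] at h
  -- `h : powSum d x + x = x + s (powSum d x)`
  change ρ s (ρ.powSum s d x) = ρ.powSum s d x
  have := congrArg (fun y => y - x) h
  simpa [add_sub_cancel_right, add_sub_cancel_left] using this.symm

/-- `s^i` fixes `N_s x` when `s^d` fixes `x`. [folklore] -/
theorem pow_apply_cycNorm {d : ℕ} {x : A} (hx : ρ (s ^ d) x = x) (i : ℕ) :
    ρ (s ^ i) (ρ.cycNorm s d x) = ρ.cycNorm s d x := by
  induction i with
  | zero => rw [pow_zero, map_one, Module.End.one_apply]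
  | succ i ih => rw [pow_succ', map_mul, Module.End.mul_apply, ih, apply_cycNorm ρ s hx]

/-- **Periodicity**: `powSum (i + d) x = powSum i x + N_s x` when `s^d` fixes `x`. [folklore] -/
theorem powSum_add_period {d : ℕ} {x : A} (hx : ρ (s ^ d) x = x) (i : ℕ) :
    ρ.powSum s (i + d) x = ρ.powSum s i x + ρ.cycNorm s d x := by
  rw [powSum_add]
  change ρ.powSum s i x + ρ (s ^ i) (ρ.cycNorm s d x) = _
  rw [pow_apply_cycNorm ρ s hx]

end PowSum

end ContinuousRep

/-! ### Elements invariant under a cyclic layer -/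

section Invariance

variable {G : Type u} [Group G] [TopologicalSpace G] {d : ℕ} [NeZero d]
variable {A : Type u} [AddCommGroup A] [TopologicalSpace A]
variable (χ : CyclicCharacter G d) (ρ : ContinuousRep G ℤ A) {s : G} (hs : χ s = 1)

include hs in
/-- `σ` acts on a `T`-invariant element as `s^{χ̃ σ}`. [folklore] -/
theorem apply_eq_pow_val_apply {y : A} (hy : ∀ t ∈ χ.ker, ρ t y = y) (σ : G) :
    ρ σ y = ρ (s ^ (χ σ).val) y := by
  conv_lhs => rw [← mul_inv_cancel_left (s ^ (χ σ).val) σ, map_mul, Module.End.mul_apply,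
    hy _ (χ.pow_val_inv_mul_mem_ker hs σ)]

omit [NeZero d] in
/-- `s^k y` is `T`-invariant if `y` is (`T` being normal). [folklore] -/
theorem ker_apply_pow_apply {y : A} (hy : ∀ t ∈ χ.ker, ρ t y = y) (k : ℕ) (t : G) (ht : t ∈ χ.ker) :
    ρ t (ρ (s ^ k) y) = ρ (s ^ k) y := by
  have hc : (s ^ k)⁻¹ * t * s ^ k ∈ χ.ker := by
    have := χ.normal_ker.conj_mem t ht (s ^ k)⁻¹
    rwa [inv_inv] at this
  have hts : t * s ^ k = s ^ k * ((s ^ k)⁻¹ * t * s ^ k) := by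
    rw [← mul_assoc, ← mul_assoc, mul_inv_cancel, one_mul]
  rw [← Module.End.mul_apply, ← map_mul, hts, map_mul, Module.End.mul_apply, hy _ hc]

omit [NeZero d] in
/-- `powSum k y` is `T`-invariant if `y` is. [folklore] -/
theorem ker_apply_powSum {y : A} (hy : ∀ t ∈ χ.ker, ρ t y = y) (i : ℕ) (t : G) (ht : t ∈ χ.ker) :
    ρ t (ρ.powSum s i y) = ρ.powSum s i y := by
  simp only [ContinuousRep.powSum, map_sum]
  exact Finset.sum_congr rfl fun k _ => ker_apply_pow_apply χ ρ hy k t ht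

include hs in
/-- **`N_s b` is `G`-invariant for `T`-invariant `b`.** [cite: SerreLocalFields1979, VIII §4] -/
theorem apply_cycNorm_eq {b : A} (hb : ∀ t ∈ χ.ker, ρ t b = b) (σ : G) :
    ρ σ (ρ.cycNorm s d b) = ρ.cycNorm s d b := by
  rw [apply_eq_pow_val_apply χ ρ hs (y := ρ.cycNorm s d b)
    (fun t ht => ker_apply_powSum χ ρ hb d t ht) σ]
  exact ρ.pow_apply_cycNorm s (hb _ (χ.pow_mem_ker hs)) _

end Invariance

/-! ### The classes `κ(a) = [c_χ ⊗ a]` -/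

section CyclicClass

variable {G : Type u} [Group G] [TopologicalSpace G] [IsTopologicalGroup G] [LocallyCompactSpace G]
variable {d : ℕ} [NeZero d] (χ : CyclicCharacter G d)
variable {A : Type u} [AddCommGroup A] [TopologicalSpace A] [DiscreteTopology A]
variable (ρ : ContinuousRep G ℤ A)

/-- **The cocycle `c_χ ⊗ a : (σ, τ) ↦ c_χ(σ, τ) a`** for a `G`-invariant `a`, a continuous
inhomogeneous `2`-cocycle with values in `A`. [folklore] -/
def carryCocycle (a : A) (ha : ∀ g : G, ρ g a = a) : contTwoCocycles ρ.toTopRep :=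
  ⟨⟨fun p => χ.carryFun p.1 p.2 • a, χ.continuous_carryFun.smul continuous_const⟩, fun σ τ υ => by
    change ρ σ (χ.carryFun τ υ • a) + χ.carryFun σ (τ * υ) • a =
      χ.carryFun (σ * τ) υ • a + χ.carryFun σ τ • a
    rw [map_zsmul, ha, ← add_smul, ← add_smul, χ.carryFun_cocycle]⟩

omit [IsTopologicalGroup G] [LocallyCompactSpace G] in
/-- Unfolding `carryCocycle`. [folklore] -/
@[simp] theorem carryCocycle_apply (a : A) (ha : ∀ g : G, ρ g a = a) (σ τ : G) :
    (carryCocycle χ ρ a ha).1 (σ, τ) = χ.carryFun σ τ • a := rfl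

/-- **The class `κ(a) = [c_χ ⊗ a] = a ∪ δχ ∈ H²(G, A)`** of a `G`-invariant `a` (for `A = L̄ˣ`,
`G = Γ_K`, the class of the cyclic algebra `(χ, a)`).  Additive in `a`.
[cite: SerreLocalFields1979, XIV §1 Prop. 2] -/
def cyclicClass : ρ.toTopRep.ρ.invariants →+ continuousCohomology 2 ρ.toTopRep where
  toFun a := twoCocycleClass _ (carryCocycle χ ρ a.1 a.2)
  map_zero' := by
    rw [← twoCocycleClass_zero]
    exact congrArg _ (Subtype.ext (ContinuousMap.ext fun q => by
      obtain ⟨σ, τ⟩ := q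
      change χ.carryFun σ τ • (0 : A) = 0
      rw [smul_zero]))
  map_add' a b := by
    rw [← twoCocycleClass_add]
    exact congrArg _ (Subtype.ext (ContinuousMap.ext fun q => by
      obtain ⟨σ, τ⟩ := q
      change χ.carryFun σ τ • (a.1 + b.1) = χ.carryFun σ τ • a.1 + χ.carryFun σ τ • b.1
      rw [smul_add]))

/-- Unfolding `cyclicClass`. [folklore] -/
theorem cyclicClass_apply (a : ρ.toTopRep.ρ.invariants) :
    cyclicClass χ ρ a = twoCocycleClass _ (carryCocycle χ ρ a.1 a.2) := rfl

/-- **`res_T κ(a) = 0`**: the carry cocycle vanishes on `T × T`.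
[cite: SerreLocalFields1979, VII §6 Prop. 5] -/
theorem map_res_cyclicClass [LocallyCompactSpace χ.ker] (a : ρ.toTopRep.ρ.invariants) :
    ContinuousCohomology.map (subgroupIncl χ.ker)
      (𝟙 (TopRep.res ((subgroupIncl χ.ker : χ.ker →ₜ* G) : χ.ker →* G) ρ.toTopRep)) 2
      (cyclicClass χ ρ a) = 0 := by
  rw [cyclicClass_apply, map_twoCocycleClass, ← twoCocycleClass_zero]
  refine congrArg _ (Subtype.ext (ContinuousMap.ext fun q => ?_))
  obtain ⟨t, t'⟩ := q
  rw [contTwoCocycles.pullback_apply]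
  change χ.carryFun (t : G) (t' : G) • a.1 = 0
  rw [χ.carryFun_of_mem_ker t.2 t'.2, zero_smul]

/-! #### `κ(N_s b) = 0` -/

variable {s : G} (hs : χ s = 1)

omit [IsTopologicalGroup G] [LocallyCompactSpace G] [DiscreteTopology A] in
include hs in
/-- **The coboundary identity `c_χ(σ, τ) · N_s b = σ β(τ) - β(στ) + β(σ)`** for
`β(σ) = Σ_{k < χ̃ σ} s^k b` and a `T`-invariant `b` (the computation behind `κ(N_s b) = 0`, also used
for the lift `Σ_{k<χ̃ σ} s^k ĩ` in the dimension shift of the sequel). [cite: SerreLocalFields1979, VIII §4] -/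
theorem carryFun_smul_cycNorm {b : A} (hb : ∀ t ∈ χ.ker, ρ t b = b) (σ τ : G) :
    χ.carryFun σ τ • ρ.cycNorm s d b =
      ρ σ (ρ.powSum s (χ τ).val b) - ρ.powSum s (χ (σ * τ)).val b + ρ.powSum s (χ σ).val b := by
  have hsd : ρ (s ^ d) b = b := hb _ (χ.pow_mem_ker hs)
  rw [apply_eq_pow_val_apply χ ρ hs (fun t ht => ker_apply_powSum χ ρ hb _ t ht) σ, χ.map_mul,
    ZMod.val_add]
  by_cases hlt : (χ σ).val + (χ τ).val < d
  · rw [χ.carryFun_of_lt hlt, zero_smul, Nat.mod_eq_of_lt hlt, ρ.powSum_add s _ _ b]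
    abel
  · have hle : d ≤ (χ σ).val + (χ τ).val := not_lt.1 hlt
    obtain ⟨m, hm⟩ := Nat.exists_eq_add_of_le hle
    have hmd : m < d := by have := (χ σ).val_lt; have := (χ τ).val_lt; omega
    rw [χ.carryFun_of_le hle, one_smul, hm, Nat.add_mod_left, Nat.mod_eq_of_lt hmd]
    have h1 := ρ.powSum_add s (χ σ).val (χ τ).val b
    rw [hm, add_comm d m, ρ.powSum_add_period s hsd m] at h1
    have e : ρ (s ^ (χ σ).val) (ρ.powSum s (χ τ).val b) =
        ρ.powSum s m b + ρ.cycNorm s d b - ρ.powSum s (χ σ).val b := by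
      rw [h1]; abel
    rw [e]; abel

include hs in
/-- **`κ(N_s b) = 0` for a `T`-invariant `b`**: `c_χ ⊗ N_s b = dβ` with
`β(σ) = Σ_{k < χ̃ σ} s^k b`. [cite: SerreLocalFields1979, VIII §4] -/
theorem cyclicClass_cycNorm {b : A} (hb : ∀ t ∈ χ.ker, ρ t b = b) :
    cyclicClass χ ρ ⟨ρ.cycNorm s d b, apply_cycNorm_eq χ ρ hs hb⟩ = 0 := by
  rw [cyclicClass_apply, twoCocycleClass_eq_zero_iff]
  exact ⟨⟨fun σ => ρ.powSum s (χ σ).val b,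
    (continuous_of_discreteTopology (f := fun x : ZMod d => ρ.powSum s x.val b)).comp χ.continuous⟩,
    fun σ τ => carryFun_smul_cycNorm χ ρ hs hb σ τ⟩

/-! #### `κ(a) = 0 ⇒ a` is a norm -/

include hs in
/-- **`κ(a) = 0` implies `a = N_s b` for some `T`-invariant `b`**, when `H¹(T, A) = 0`
(`T = ker χ` with the subspace topology).  If `c_χ ⊗ a = dβ`: by Hilbert 90 for `T` we may assume
`β|_T = 0`; then `β(σ t) = β(σ)`, `β(t σ) = t β(σ) = β(σ)` (`t ∈ T`), `β(sⁱ) = Σ_{k<i} s^k β(s)` for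
`i < d`, and evaluating at `(s^{d-1}, s)` gives `a = N_s β(s)`.
[cite: SerreLocalFields1979, VIII §4 and XIV §1 Prop. 3] -/
theorem exists_cycNorm_eq_of_cyclicClass_eq_zero [Fact (1 < d)]
    (hT : Subsingleton (continuousCohomology 1 ((ρ.restrict (subgroupIncl χ.ker)).toTopRep)))
    (a : ρ.toTopRep.ρ.invariants) (h0 : cyclicClass χ ρ a = 0) :
    ∃ b : A, (∀ t ∈ χ.ker, ρ t b = b) ∧ ρ.cycNorm s d b = a.1 := by
  rw [cyclicClass_apply, twoCocycleClass_eq_zero_iff] at h0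
  obtain ⟨β₀, hβ₀⟩ := h0
  have hβ₀' : ∀ σ τ, χ.carryFun σ τ • a.1 = ρ σ (β₀ τ) - β₀ (σ * τ) + β₀ σ := fun σ τ => hβ₀ σ τ
  -- Step 1: `β₀|_T` is a crossed homomorphism, hence principal; normalise it to `0`
  let φ : contOneCocycles ((ρ.restrict (subgroupIncl χ.ker)).toTopRep) :=
    ⟨β₀.comp ⟨((↑) : χ.ker → G), continuous_subtype_val⟩, fun t t' => by
      change β₀ ((t : G) * t') = β₀ t + ρ (t : G) (β₀ t')
      have h := hβ₀' t t'
      rw [χ.carryFun_of_mem_ker t.2 t'.2, zero_smul] at h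
      rw [← sub_eq_zero, ← neg_eq_zero]
      rw [eq_comm, ← sub_eq_zero] at h
      rw [← h]; abel⟩
  obtain ⟨y, hy⟩ := (oneCocycleClass_eq_zero_iff _ φ).1 (Subsingleton.elim _ _)
  have hy' : ∀ t ∈ χ.ker, β₀ t = ρ t y - y := fun t ht => hy ⟨t, ht⟩
  let β : C(G, A) := β₀ - ⟨fun σ => ρ σ y - y, (ρ.continuous_apply_left y).sub continuous_const⟩
  have hβv : ∀ σ, β σ = β₀ σ - (ρ σ y - y) := fun _ => rfl
  have hβ : ∀ σ τ, χ.carryFun σ τ • a.1 = ρ σ (β τ) - β (σ * τ) + β σ := fun σ τ => by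
    rw [hβv, hβv, hβv, hβ₀' σ τ, map_sub, map_sub, _root_.map_mul ρ, Module.End.mul_apply]
    abel
  have hβT : ∀ t ∈ χ.ker, β t = 0 := fun t ht => by rw [hβv, hy' t ht, sub_self]
  -- Step 2: `β` is constant on cosets of `T`, with values in `A^T`
  have hR : ∀ σ, ∀ t ∈ χ.ker, β (σ * t) = β σ := fun σ t ht => by
    have h := hβ σ t
    rw [χ.carryFun_right_of_mem_ker σ ht, zero_smul, hβT t ht, map_zero, zero_sub] at h
    exact neg_add_eq_zero.1 h.symm
  have hL : ∀ t ∈ χ.ker, ∀ τ, β (t * τ) = ρ t (β τ) := fun t ht τ => by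
    have h := hβ t τ
    rw [χ.carryFun_left_of_mem_ker ht τ, zero_smul, hβT t ht, add_zero] at h
    exact (sub_eq_zero.1 h.symm).symm
  have hTinv : ∀ τ, ∀ t ∈ χ.ker, ρ t (β τ) = β τ := fun τ t ht => by
    rw [← hL t ht τ]
    have hc : τ⁻¹ * t * τ ∈ χ.ker := by
      have := χ.normal_ker.conj_mem t ht τ⁻¹
      rwa [inv_inv] at this
    rw [show t * τ = τ * (τ⁻¹ * t * τ) by group]
    exact hR τ _ hc
  -- Step 3: `β(sⁱ) = Σ_{k<i} s^k β(s)` for `i < d`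
  set b := β s with hb
  have hval1 : (χ s).val = 1 := by rw [hs, ZMod.val_one]
  have hpow : ∀ i, i < d → β (s ^ i) = ρ.powSum s i b := by
    intro i
    induction i with
    | zero =>
      intro _
      rw [pow_zero, ρ.powSum_zero, hβT 1 χ.ker.one_mem]
    | succ i ih =>
      intro hi
      have h := hβ (s ^ i) s
      rw [χ.carryFun_of_lt (by rw [χ.val_map_pow hs (Nat.lt_of_succ_lt hi), hval1]; exact hi),
        zero_smul, ← pow_succ, ih (Nat.lt_of_succ_lt hi), ← hb] at h
      rw [ρ.powSum_succ]
      have e : β (s ^ (i + 1)) - (ρ.powSum s i b + ρ (s ^ i) b) =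
          -(ρ (s ^ i) b - β (s ^ (i + 1)) + ρ.powSum s i b) := by abel
      rw [← sub_eq_zero, e, ← h, neg_zero]
  -- Step 4: evaluate at `(s^{d-1}, s)`
  refine ⟨b, fun t ht => hTinv s t ht, ?_⟩
  obtain ⟨e, he⟩ := Nat.exists_eq_add_of_le (Fact.out : 1 < d).le
  have hed : e + 1 = d := by omega
  have h := hβ (s ^ e) s
  rw [χ.carryFun_of_le (by rw [χ.val_map_pow hs (by omega), hval1]; omega), one_smul,
    ← pow_succ, hed, hβT _ (χ.pow_mem_ker hs), sub_zero, hpow e (by omega)] at h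
  rw [h, ContinuousRep.cycNorm, ← hed, ρ.powSum_succ, add_comm]

end CyclicClass

end Literature.NumberTheory.GaloisRepresentations

end
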